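import Mathlib.Tactic

/-!
# CLAIM O — finite model (bsd-idea-19 g24, 2026-08-29)

Work-file model (NOT a Theorems file; imported by nothing) of CLAIM O from
`Lines/two-parity-modular-unit-note.md` §5 step (1):

  a function `λ` on the primitive vectors `P(N)` of `(ℤ/N)²` that is *1-old* along every
  unimodular line `t ↦ u r₁ + t r₂` (i.e. `Σ_t λ(u r₁ + t r₂) ζ_N^{tc} = 0` for every unit `c`)
  lies in `OLD = Σ_{q ∣ N} π*_{N/q}(functions on (ℤ/(N/q))²)` restricted to `P(N)`.

We check the dimension identity `dim{1-old on all unimodular lines} = dim OLD|_P`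
(and `= dim span of the top layers 1_{v ≡ w (D)}|_P of the R_μ generators`) over the
prime field `𝔽_ℓ` with `N ∣ ℓ - 1` (so that `ζ_N ∈ 𝔽_ℓ`), by exact Gaussian elimination and
`native_decide`, for `(N, ℓ) ∈ {(4,5), (6,7), (6,13), (12,13)}` — the last is literally the field
of the BSD prime `p = 13` at co-level `M′ = 12`.  Inclusion `OLD|_P ⊆ {1-old}` is clear, so equal
dimensions give equality.  Nothing here proves BSD / C5 / R / I9; it is a sanity model.
-/

set_option linter.dupNamespace false

namespace Summit.BirchSwinnertonDyer.BirchSwinnertonDyer.Cruxes.ManinPrimeToAdditiveFiveLe.TwoParity.ClaimO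

/-- primitive vectors of `(ℤ/N)²` as a list of pairs -/
def prims (N : ℕ) : List (ℕ × ℕ) :=
  ((List.range N).flatMap fun x => (List.range N).map fun y => (x, y)).filter
    fun v => Nat.gcd (Nat.gcd v.1 v.2) N == 1

def units (N : ℕ) : List ℕ := (List.range N).filter fun u => Nat.gcd u N == 1

/-- position of a vector in `prims N` (vectors are reduced mod `N` first) -/
def pidx (N : ℕ) (v : ℕ × ℕ) : ℕ :=
  ((prims N).findIdx? (fun w => w == (v.1 % N, v.2 % N))).getD 0

/-- some `r₁ = (c,d)` with `c*b - d*a ≡ 1 (mod N)` for primitive `r₂ = (a,b)` -/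
def partner (N : ℕ) (r2 : ℕ × ℕ) : ℕ × ℕ :=
  (((List.range N).flatMap fun c => (List.range N).map fun d => (c, d)).find?
    (fun cd => (cd.1 * r2.2 + (N - (cd.2 * r2.1) % N)) % N == 1 % N)).getD (0, 0)

/-- the points `u r₁ + t r₂`, `t = 0..N-1`, of a unimodular line -/
def linePts (N : ℕ) (r2 : ℕ × ℕ) (u : ℕ) : List (ℕ × ℕ) :=
  let r1 := partner N r2
  (List.range N).map fun t => ((u * r1.1 + t * r2.1) % N, (u * r1.2 + t * r2.2) % N)

def addAt (l : ℕ) (row : List ℕ) (j val : ℕ) : List ℕ := row.set j ((row.getD j 0 + val) % l)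

/-- constraint row over `𝔽_ℓ`: `Σ_t ζ^{t c} e_{line(t)}` -/
def lineRow (N l zeta : ℕ) (r2 : ℕ × ℕ) (u c : ℕ) : List ℕ :=
  let n := (prims N).length
  ((List.range N).zip (linePts N r2 u)).foldl
    (fun row tp => addAt l row (pidx N tp.2) ((zeta ^ ((tp.1 * c) % N)) % l))
    (List.replicate n 0)

def constraintRows (N l zeta : ℕ) : List (List ℕ) :=
  (prims N).flatMap fun r2 => (units N).flatMap fun u => (units N).map fun c => lineRow N l zeta r2 u c

def primeDivs (N : ℕ) : List ℕ := (List.range (N + 1)).filter fun q => q.Prime && N % q == 0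

/-- indicator rows of `{v ∈ P(N) : v ≡ w (mod D)}` for the given list of moduli `D` -/
def indicatorRows (N : ℕ) (Ds : List ℕ) : List (List ℕ) :=
  Ds.flatMap fun D => (List.range D).flatMap fun w0 => (List.range D).map fun w1 =>
    (prims N).map fun v => if v.1 % D == w0 && v.2 % D == w1 then 1 else 0

def reduceRow (p : ℕ) (r : List ℕ) (piv : List (ℕ × List ℕ)) : List ℕ :=
  piv.foldl (fun r cp =>
      let c := r.getD cp.1 0
      if c == 0 then r else List.zipWith (fun x y => (x + (p - c * y % p)) % p) r cp.2)
    r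

def insertSorted (cp : ℕ × List ℕ) (piv : List (ℕ × List ℕ)) : List (ℕ × List ℕ) :=
  (piv.filter (fun q => q.1 < cp.1)) ++ [cp] ++ (piv.filter (fun q => cp.1 < q.1))

/-- rank over `𝔽_p` of a list of rows, by Gaussian elimination -/
def rankModP (p : ℕ) (rows : List (List ℕ)) : ℕ :=
  (rows.foldl (fun piv r =>
      let r' := reduceRow p (r.map (fun x => x % p)) piv
      match r'.findIdx? (fun x => x != 0) with
      | none => piv
      | some col =>
        let inv := ((r'.getD col 0) ^ (p - 2)) % p
        insertSorted (col, r'.map (fun x => x * inv % p)) piv)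
    []).length

/-- `(dim{λ : 1-old on every unimodular line}, dim OLD|_P, dim span(top layers of R-generators))`
over `𝔽_ℓ`, `ζ` an element of exact order `N` in `𝔽_ℓ`. -/
def claimODims (N l zeta : ℕ) : ℕ × ℕ × ℕ :=
  let n := (prims N).length
  (n - rankModP l (constraintRows N l zeta),
   rankModP l (indicatorRows N ((primeDivs N).map fun q => N / q)),
   rankModP l (indicatorRows N (((List.range N).filter fun D => 0 < D && N % D == 0))))

/-- sanity: `ζ` has exact order `N` in `𝔽_ℓ` -/
def exactOrder (N l zeta : ℕ) : Bool :=
  (zeta ^ N) % l == 1 && ((List.range N).filter fun j => 0 < j && (zeta ^ j) % l == 1).isEmpty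

theorem order_4_5 : exactOrder 4 5 2 = true := by decide
theorem order_6_7 : exactOrder 6 7 3 = true := by decide
theorem order_6_13 : exactOrder 6 13 4 = true := by decide
theorem order_12_13 : exactOrder 12 13 2 = true := by decide

/-- N = 4 over 𝔽_5 (ζ = 2): #P = 12, all three dimensions = 3. -/
theorem claimO_4_5 : claimODims 4 5 2 = (3, 3, 3) := by native_decide
/-- N = 6 over 𝔽_7 (ζ = 3): #P = 24, all three dimensions = 10. -/
theorem claimO_6_7 : claimODims 6 7 3 = (10, 10, 10) := by native_decide
/-- N = 6 over 𝔽_13 (ζ = 4). -/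
theorem claimO_6_13 : claimODims 6 13 4 = (10, 10, 10) := by native_decide
/-- N = 12 over 𝔽_13 (ζ = 2): #P = 96, all three dimensions = 33 — the field of the BSD prime 13
at co-level 12. -/
theorem claimO_12_13 : claimODims 12 13 2 = (33, 33, 33) := by native_decide

end Summit.BirchSwinnertonDyer.BirchSwinnertonDyer.Cruxes.ManinPrimeToAdditiveFiveLe.TwoParity.ClaimO
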